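import Summits.CriticalPhenomena.SAWScalingLimit.Theorems.SAWDevelopingMapHexConjectureReflexCellCeilingArc

/-!
# What the flux line of `W_N` says about the RAY masses: only their difference

Line `marginal-reflex-wedge-cauchy-kernel` of the crux `HexConjecture` (stmt-CriticalPhenomena-0808),
companion of `SAWDevelopingMapHexConjectureReflexCellCeilingArc` (helper file of the stub
`stub_reflexCellCeiling`).

Rotating the flux line `Φ_N = (2√3)⁻¹ (-i - e^{-iπ/8} (Z₀ - Z₆₀))` by `e^{i5π/8}` puts the two ray masses
on the IMAGINARY axis: `Im(e^{i5π/8} Φ_N) = (2√3)⁻¹ (sin(π/8) - (Z₀ - Z₆₀))`, while the arc side has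
`|Im| ≤ (2√3)⁻¹ Σ_arc Zm ≤ (2√3)⁻¹ (1 + √2)` by the arc ceiling `arcMass_le_of_arcPhases`. Hence

  `|Z₀^{(N)} - Z₆₀^{(N)} - sin(π/8)| ≤ 1 + √2` uniformly in `N`

(`rayMassDiff_le_of_arcPhases`). This is ALL the single complex flux identity of `W_N` knows about the
ray masses: the `0°`-ray and `60°`-ray phases `-π/8`, `7π/8` are antipodal, so `Z₀ + Z₆₀` (the ray half of
`ReflexCellCeiling`, expected `≍ log N`: corner exponent `3/8` plus boundary exponent `5/8`) is invisible
to it — the missing estimate is a corner-to-boundary two-point decay, not an identity.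

Source: H. Duminil-Copin, S. Smirnov, Ann. of Math. 175 (2012), Lemma 1 and §3.
-/

noncomputable section

open scoped BigOperators Classical
open Literature.Probability.LatticeModels Literature.Probability.RandomPlanarGeometry
  Literature.Probability.RandomPlanarGeometry.SAW
open Literature.Barriers.CriticalPhenomena.HexGreen (nbrs mem_nbrs_iff)

namespace Summit.CriticalPhenomena.SAWScalingLimit.Theorems.HexConjecture.MarginalWedge

namespace Ceiling

/-- **One arc dart, exactly.** With `c_w - c_v = (√3)⁻¹ e^{iθ}` and rigid winding `θ + π/2` on
`s(v, w)`, the flux term rotated by `e^{i5π/8}` is `(2√3)⁻¹ Zm · e^{i(3θ/8 + 5π/16)}`.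
[cite: DuminilCopinSmirnov2012, §3 proof of Lemma 2] -/
theorem dart_term_eq {Λ : Finset HexVertex} {v w : HexVertex} {θ : ℝ}
    (hd : hexCenter w - hexCenter v = ((Real.sqrt 3)⁻¹ : ℝ) * Complex.exp (θ * Complex.I))
    (hW : ∀ γ : HexMidEdgeSAW Λ cornerEdge s(v, w), γ.winding = θ + Real.pi / 2) :
    Complex.exp ((5 * Real.pi / 8 : ℝ) * Complex.I) *
        ((hexMidpoint s(v, w) - hexCenter v) * Fc Λ (5 / 8) s(v, w)) =
      ((1 / (2 * Real.sqrt 3) * Zm Λ cornerEdge s(v, w) : ℝ) : ℂ) *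
        Complex.exp ((3 * θ / 8 + 5 * Real.pi / 16 : ℝ) * Complex.I) := by
  have hmid : hexMidpoint s(v, w) - hexCenter v = (hexCenter w - hexCenter v) / 2 := by
    rw [hexMidpoint_mk]; ring
  have hexp : Complex.exp ((5 * Real.pi / 8 : ℝ) * Complex.I) * Complex.exp (θ * Complex.I) *
      Complex.exp (-Complex.I * (5 / 8 : ℝ) * (θ + Real.pi / 2 : ℝ)) =
      Complex.exp ((3 * θ / 8 + 5 * Real.pi / 16 : ℝ) * Complex.I) := by
    rw [← Complex.exp_add, ← Complex.exp_add]
    congr 1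
    push_cast
    ring
  rw [hmid, hd, Fc_eq_of_winding hW, ← hexp]
  push_cast
  field_simp

/-- The imaginary part of one rotated arc term is at most `(2√3)⁻¹ Zm` in absolute value. [folklore] -/
theorem abs_dart_im_le {Λ : Finset HexVertex} {v w : HexVertex} {θ : ℝ}
    (hd : hexCenter w - hexCenter v = ((Real.sqrt 3)⁻¹ : ℝ) * Complex.exp (θ * Complex.I))
    (hW : ∀ γ : HexMidEdgeSAW Λ cornerEdge s(v, w), γ.winding = θ + Real.pi / 2) :
    |(Complex.exp ((5 * Real.pi / 8 : ℝ) * Complex.I) *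
        ((hexMidpoint s(v, w) - hexCenter v) * Fc Λ (5 / 8) s(v, w))).im| ≤
      1 / (2 * Real.sqrt 3) * Zm Λ cornerEdge s(v, w) := by
  have hK : 0 ≤ 1 / (2 * Real.sqrt 3) * Zm Λ cornerEdge s(v, w) :=
    mul_nonneg (by positivity) (Zm_nonneg _ _ _)
  rw [dart_term_eq hd hW, Complex.im_ofReal_mul, Complex.exp_ofReal_mul_I_im, abs_mul,
    abs_of_nonneg hK]
  exact mul_le_of_le_one_right hK (Real.abs_sin_le_one _)

/-- **The rotated flux line, imaginary part.** `Im(e^{i5π/8} · (2√3)⁻¹ (-i - e^{-iπ/8} r)) =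
(2√3)⁻¹ (sin(π/8) - r)`: the ray masses sit on the imaginary axis. [folklore] -/
theorem im_rotated_fluxLine (r : ℝ) :
    (Complex.exp ((5 * Real.pi / 8 : ℝ) * Complex.I) * ((1 / (2 * Real.sqrt 3) : ℂ) *
      (-Complex.I - Complex.exp (-Complex.I * (Real.pi / 8)) * (r : ℂ)))).im =
      1 / (2 * Real.sqrt 3) * (Real.sin (Real.pi / 8) - r) := by
  have hI : Complex.exp ((5 * Real.pi / 8 : ℝ) * Complex.I) *
      Complex.exp (-Complex.I * (Real.pi / 8)) = Complex.I := by
    rw [← Complex.exp_add]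
    have : ((5 * Real.pi / 8 : ℝ) : ℂ) * Complex.I + -Complex.I * (Real.pi / 8) =
        ((Real.pi / 2 : ℝ) : ℂ) * Complex.I := by
      push_cast
      ring
    rw [this]
    apply Complex.ext
    · simp
    · simp
  calc (Complex.exp ((5 * Real.pi / 8 : ℝ) * Complex.I) * ((1 / (2 * Real.sqrt 3) : ℂ) *
        (-Complex.I - Complex.exp (-Complex.I * (Real.pi / 8)) * (r : ℂ)))).im
      = (((1 / (2 * Real.sqrt 3) : ℝ) : ℂ) *
          (-Complex.I * Complex.exp ((5 * Real.pi / 8 : ℝ) * Complex.I) -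
            (Complex.exp ((5 * Real.pi / 8 : ℝ) * Complex.I) *
              Complex.exp (-Complex.I * (Real.pi / 8))) * (r : ℂ))).im := by
        congr 1
        push_cast
        ring
    _ = 1 / (2 * Real.sqrt 3) * (-Real.cos (5 * Real.pi / 8) - r) := by
        rw [hI, Complex.im_ofReal_mul]
        congr 1
        simp only [Complex.sub_im, Complex.mul_im, Complex.neg_re, Complex.neg_im, Complex.I_re,
          Complex.I_im, Complex.ofReal_re, Complex.ofReal_im, Complex.exp_ofReal_mul_I_re,
          Complex.exp_ofReal_mul_I_im]
        ring
    _ = 1 / (2 * Real.sqrt 3) * (Real.sin (Real.pi / 8) - r) := by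
        rw [show 5 * Real.pi / 8 = Real.pi / 8 + Real.pi / 2 by ring, Real.cos_add_pi_div_two, neg_neg]

end Ceiling

open Ceiling in
/-- **The flux line pins the DIFFERENCE of the ray masses.** Under the flux line of `W_N` (conclusion
of `stub_reflexFluxLine`) and the arc-phase confinement `θ ∈ [-11π/6, π/6]` of its arc darts, the two
ray masses of the corner-rooted critical observable satisfy `|Z₀ - Z₆₀ - sin(π/8)| ≤ 1 + √2`, uniformly
in `N`; their SUM is not controlled by the identity (antipodal ray phases). Registered sub-goal
`rayMassDiff_le_of_arcPhases` of the crux skeleton. [cite: DuminilCopinSmirnov2012, Lemma 1 and §3] -/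
theorem rayMassDiff_le_of_arcPhases : ∀ (Λ : Finset HexVertex) (N : ℝ), farFlux Λ N = (1 / (2 * Real.sqrt 3) : ℂ) * (-Complex.I - Complex.exp (-Complex.I * (Real.pi / 8)) * ((rayZeroMass Λ N - raySixtyMass Λ N : ℝ) : ℂ)) → (∀ v w : HexVertex, v ∈ Λ → w ∉ Λ → hexGraph.Adj v w → IsArcDart N v w → ∃ θ : ℝ, -(11 * Real.pi / 6) ≤ θ ∧ θ ≤ Real.pi / 6 ∧ hexCenter w - hexCenter v = ((Real.sqrt 3)⁻¹ : ℝ) * Complex.exp (θ * Complex.I) ∧ ∀ γ : HexMidEdgeSAW Λ cornerEdge s(v, w), γ.winding = θ + Real.pi / 2) → |rayZeroMass Λ N - raySixtyMass Λ N - Real.sin (Real.pi / 8)| ≤ 1 + Real.sqrt 2 := by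
  intro Λ N hflux harc
  have hK : 0 < 1 / (2 * Real.sqrt 3) := by
    have h3 : 0 < Real.sqrt 3 := Real.sqrt_pos.2 (by norm_num)
    positivity
  have harcmass := arcMass_le_of_arcPhases Λ N hflux harc
  -- the arc side: `|Im| ≤ (2√3)⁻¹ Σ_arc Zm`
  have h1 : |(Complex.exp ((5 * Real.pi / 8 : ℝ) * Complex.I) * farFlux Λ N).im| ≤
      1 / (2 * Real.sqrt 3) * dartSum Λ (IsArcDart N) fun v w => Zm Λ cornerEdge s(v, w) := by
    rw [farFlux, dartSum, dartSum]
    simp only [Finset.mul_sum, Complex.im_sum]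
    refine (Finset.abs_sum_le_sum_abs _ _).trans (Finset.sum_le_sum fun v hv => ?_)
    refine (Finset.abs_sum_le_sum_abs _ _).trans (Finset.sum_le_sum fun w hw => ?_)
    rw [Finset.mem_filter] at hw
    obtain ⟨θ, -, -, hd, hW⟩ := harc v w hv hw.2.1 ((mem_nbrs_iff v w).1 hw.1) hw.2.2
    exact abs_dart_im_le hd hW
  -- the ray side
  rw [hflux, im_rotated_fluxLine, abs_mul, abs_of_pos hK] at h1
  have h2 : |Real.sin (Real.pi / 8) - (rayZeroMass Λ N - raySixtyMass Λ N)| * (1 / (2 * Real.sqrt 3)) ≤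
      (1 + Real.sqrt 2) * (1 / (2 * Real.sqrt 3)) := by
    nlinarith [h1, harcmass]
  rw [abs_sub_comm]
  exact le_of_mul_le_mul_right h2 hK

end Summit.CriticalPhenomena.SAWScalingLimit.Theorems.HexConjecture.MarginalWedge

end
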